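import Summits.QuantumFields.BalabanUV.Beta.GAN24.DerivativeRateTransferPropagatorDefect

/-!
# `BalabanUV.Beta.GAN24.DerivativeRateTransferPropagatorDefectEnd` — binder row G-an2-4 ∕ (CONV-C), route R6 «VALUES, NOT DERIVATIVES», PART 46:
# THE DIRECT TOWER END WITH A PHYSICAL MASS — (CONS♭) from the propagator-defect row at ONE mass per level, `m_j = μ·η_j²` (the geometric schedule
# `m_j² ≤ μ′·θ^j`), + (SRC-f) + (AVG) + (VAL₁) + (LEGS); no massless limit, no `(0, m₀)`-uniformity; + CHANGE OF COARSE FRAME (unit b2b-balaban-gan24-p3, gen 41; v1.2 = v1 + one docstring sentence (gan24-idea-1 g53 W-1 (R-a), v1.1) + §3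
# «change of coarse frame» (4 thm, after kit j171386) — §1–§2 statements and proofs byte-identical to the staged v1)

NOT IN PRINT; OUR PROOF (for the ROUTE; [folklore] finite-dimensional linear algebra — PART 45 `DerivativeRateTransferPropagatorDefect.sqConsistency_mass_of_propagatorDefect`,
PART 44 `DerivativeRateTransferKKTSourcesFluc.mul_dMinOp_eq`, an2's `CompositionSingular.kkt_mul_blocks` and Mathlib's `Matrix.IsUnit.posSemidef_star_left_conjugate_iff` BY NAME).
HONEST FRAMING (cell contract, verbatim): «discharging `BetaPertH` makes Bałaban's UV stability UNCONDITIONAL — a real constructive-QFT result; it is NOT the continuum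
limit and NOT the Clay problem.»  HONEST DEPENDENCY (verbatim): «continuum YM on T⁴ ⇐ BetaPertH ∧ nine spine estimates (0/9 proved); BetaPertH ⇐ (D1) ∧ (D4) ∧ CAP+tail;
G-an2-4 gates asym, D1 and NE2/3/4.»

WHY THIS FILE.  PART 45 reads the second-order consistency row (F1′) of the direct road in propagator currency and discharges PART 44's massless `hF1` from a
propagator-defect row UNIFORM on a mass window `(0, m₀)`.  The covariant toy of the records NOTE (kit j170612 ∕ j170995 ∕ j171034; d = 2 `U(1)`, centre-rooted
averaging) says that uniformity is the wrong currency for a CLASS of backgrounds (the massless constant is `∝ 1∕s²` for zero-flux backgrounds of amplitude `s`: the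
would-be zero mode), whereas AT ONE PHYSICAL MASS `m_j = μη_j²` the row holds with the flat constant, uniformly in the level.  THIS FILE is the tower END in that
currency: at level `j` ONE mass `m_j > 0` with `m_j² ≤ μ′θ^j` (for `m_j = μη_j² = μL^{−2j}` this is `θ = L⁻⁴ ≤ L⁻²`, finer than needed), the (E-ROW) at that mass,
and a (LEGS) row `‖ℋ̃_{j,1}e‖² ≤ N‖e‖²` on the minimiser jet paying for the `m_j²‖φ‖²` the mass brings in.

WHAT THIS FILE PROVES (0 sorry, 0 `def`, nothing cited; `ℝ`):
* §1 `sq_add_mass_le` (`‖(Λ + m·1)v‖² ≤ 2‖Λv‖² + 2m²‖v‖²`), **`jet_constrained_energy_le_of_mass_defect`** — (CONS♭) AT ONE LEVEL FROM THE PROPAGATOR ROW AT ONE MASS: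
  `H, H′ ⪰ 0`, `kkt H′ q` and `kkt Λ Q` nonsingular (`Λ = 𝒮(H′,q)`), `m > 0`, (E-ROW)_m `(H + m·1)⁻¹ − q(H′ + qᵀ(m·1)q)⁻¹qᵀ ≤ c·1` ⟹ for every direction `(Λ₁, Q₁)` and
  every `e`: `⟨dℋe,(Λ − H)dℋe⟩ ≤ 4c(‖f₁e‖² + ‖Qᵀd𝒮 e‖²) + 2c·m²·‖dℋe‖²` (`f₁ = Q₁ᵀ𝒮_Λ − Λ₁ℋ_Λ`, `dℋ = dℋ(Λ,Q;Λ₁,Q₁)`, `d𝒮 = d𝒮(Λ,Q;Λ₁,Q₁)`).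
* §2 THE TOWER END **`jetRange_cons_rate_of_massSchedule`**: `H j ⪰ 0`, nonsingular `kkt (H (j+1)) (Qf j)`, `kkt Λ_j (Qc j)`, masses `0 < m j` with `(m j)² ≤ μ′θ^j`,
  (E-ROW)_j at mass `m j` with constant `c₁`, (SRC-f) `c_F θ^j`, (AVG) `g θ^j`, (VAL₁) `V`, (LEGS) `N` ⟹
  `⟨ℋ̃_{j,1}e,(Λ_j − H_j)ℋ̃_{j,1}e⟩ ≤ (4c₁(c_F + g·V) + 2c₁μ′N)·θ^j·⟨e,e⟩` ∀ j e.
* §3 CHANGE OF COARSE FRAME (any field; the algebraic skeleton of the toy's «(STAB) is a property of the PAIR (averaging, coarse background)»): for an invertible `A`,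
  **`kktInv_frame`** (`(kkt H (A·Q))⁻¹ = [[𝒢, ℋA⁻¹],[A⁻ᵀℋᴸ, −A⁻ᵀ𝒮A⁻¹]]`), `effForm_frame` (`𝒮(H, A·Q) = A⁻ᵀ𝒮(H,Q)A⁻¹`, `ℋ(H,A·Q) = ℋ(H,Q)A⁻¹`, `𝒢` unchanged),
  `effForm_frame_sub` (`𝒮(H′, A·q) − H = A⁻ᵀ(𝒮(H′,q) − AᵀHA)A⁻¹`) and (ℝ) **`stab_frame_iff`** (`𝒮(H′, A·q) − H ⪰ 0 ⟺ 𝒮(H′, q) − AᵀHA ⪰ 0`): re-rooting the block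
  average by a coarse frame change `A` is the same as conjugating the coarse form — whence the toy's «corner + straight FAILS, corner + `Ū` and centre + straight HOLD».
WHAT IT DOES NOT DO: supply any row for Bałaban's operators; assert anything printed.  SUPPLIER work on route R6 (rank 2, REDUCTION, no seat); no consumer of record;
NEVER «G-an2-4 closed»; NOT (CONV-C), NOT D1, NOT `BetaPertH`, NOT continuum, NOT Clay.  Records: `HOME/b2b-balaban-gan24-p3/WOODBURY-FIBRE.md` v14.1,
`HOME/b2b-balaban-gan24-p3/gen41/R6-PROPAGATOR-DEFECT-NOTE.md`.
-/

noncomputable section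

open Matrix

namespace Summit.QuantumFields.BalabanUV.Beta.GAN24.DerivativeRateTransferPropagatorDefectEnd

open Literature.MathematicalPhysics.QuantumFieldTheory.Balaban1983to89.Beta.Composition (kkt blockProp)
open Literature.MathematicalPhysics.QuantumFieldTheory.Balaban1983to89.Beta.CompositionSingular (effForm minOp minOpL flucCov kkt_mul_blocks kkt_eq_fromBlocks)
open Literature.MathematicalPhysics.QuantumFieldTheory.Balaban1983to89.Beta.BorderedJets (dMinOp dEffForm)
open Summit.QuantumFields.BalabanUV.Beta.GAN24.DerivativeRateTransferKKTSourcesFluc (mul_dMinOp_eq)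
open Summit.QuantumFields.BalabanUV.Beta.GAN24.DerivativeRateTransferPropagatorDefect (sqConsistency_mass_of_propagatorDefect)

/-! ## §1 One level: (CONS♭) from the propagator row at one mass -/

section OneLevel

variable {ν μ c : Type*} [Fintype ν] [Fintype μ] [Fintype c] [DecidableEq ν] [DecidableEq μ] [DecidableEq c]

omit [DecidableEq μ] in
/-- [folklore] `‖(Λ + m·1)v‖² ≤ 2‖Λv‖² + 2m²‖v‖²` (parallelogram). -/
theorem sq_add_mass_le [DecidableEq μ] (Λ : Matrix μ μ ℝ) (m : ℝ) (v : μ → ℝ) :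
    ((Λ + m • (1 : Matrix μ μ ℝ)) *ᵥ v) ⬝ᵥ ((Λ + m • (1 : Matrix μ μ ℝ)) *ᵥ v) ≤ 2 * ((Λ *ᵥ v) ⬝ᵥ (Λ *ᵥ v)) + 2 * m ^ 2 * (v ⬝ᵥ v) := by
  have e : (Λ + m • (1 : Matrix μ μ ℝ)) *ᵥ v = Λ *ᵥ v + m • v := by rw [add_mulVec, smul_mulVec, one_mulVec]
  rw [e]
  set a : μ → ℝ := Λ *ᵥ v
  have h0 : 0 ≤ (a - m • v) ⬝ᵥ (a - m • v) := by
    simpa only [star_trivial, one_mulVec] using Matrix.PosSemidef.one.dotProduct_mulVec_nonneg (n := μ) (R := ℝ) (a - m • v)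
  simp only [add_dotProduct, dotProduct_add, sub_dotProduct, dotProduct_sub, smul_dotProduct, dotProduct_smul, smul_eq_mul] at h0 ⊢
  nlinarith [h0, dotProduct_comm a v]

variable {H : Matrix μ μ ℝ} {H' : Matrix ν ν ℝ} {q : Matrix μ ν ℝ} {Q : Matrix c μ ℝ} {m : ℝ}

/-- **`jet_constrained_energy_le_of_mass_defect` — (CONS♭) AT ONE LEVEL FROM THE PROPAGATOR ROW AT ONE MASS** [our proof]: with `Λ := 𝒮(H′,q)`: `H, H′ ⪰ 0`, `kkt H′ q`
and `kkt Λ Q` nonsingular, `m > 0`, (E-ROW)_m `⟨w,((H + m·1)⁻¹ − q(H′ + qᵀ(m·1)q)⁻¹qᵀ)w⟩ ≤ c⟨w,w⟩` (`c ≥ 0`) ⟹ for every direction `(Λ₁, Q₁)` and every `e`: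
`⟨dℋe,(Λ − H)dℋe⟩ ≤ 4c(⟨f₁e,f₁e⟩ + ⟨Qᵀd𝒮e,Qᵀd𝒮e⟩) + 2c·m²·⟨dℋe,dℋe⟩` — PART 45's (F1′)_m, the parallelogram, and PART 44's differentiated Euler–Lagrange equation
`Λ·dℋ = f₁ + Qᵀd𝒮`. -/
theorem jet_constrained_energy_le_of_mass_defect (hH : H.PosSemidef) (hH' : H'.PosSemidef) (hk : IsUnit (kkt H' q).det)
    (hΛ : IsUnit (kkt (effForm H' q) Q).det) (hm : 0 < m) {C : ℝ} (hC : 0 ≤ C)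
    (hE : ∀ w : μ → ℝ, w ⬝ᵥ (((H + m • (1 : Matrix μ μ ℝ))⁻¹ - blockProp (H' + qᵀ * (m • (1 : Matrix μ μ ℝ)) * q) q) *ᵥ w) ≤ C * (w ⬝ᵥ w))
    (Λ₁ : Matrix μ μ ℝ) (Q₁ : Matrix c μ ℝ) (e : c → ℝ) :
    (dMinOp (effForm H' q) Q Λ₁ Q₁ *ᵥ e) ⬝ᵥ ((effForm H' q - H) *ᵥ (dMinOp (effForm H' q) Q Λ₁ Q₁ *ᵥ e)) ≤
      4 * C * ((((Q₁ᵀ * effForm (effForm H' q) Q - Λ₁ * minOp (effForm H' q) Q) *ᵥ e) ⬝ᵥ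
          ((Q₁ᵀ * effForm (effForm H' q) Q - Λ₁ * minOp (effForm H' q) Q) *ᵥ e)) +
        ((Qᵀ *ᵥ (dEffForm (effForm H' q) Q Λ₁ Q₁ *ᵥ e)) ⬝ᵥ (Qᵀ *ᵥ (dEffForm (effForm H' q) Q Λ₁ Q₁ *ᵥ e)))) +
      2 * C * m ^ 2 * ((dMinOp (effForm H' q) Q Λ₁ Q₁ *ᵥ e) ⬝ᵥ (dMinOp (effForm H' q) Q Λ₁ Q₁ *ᵥ e)) := by
  set Λ : Matrix μ μ ℝ := effForm H' q with hΛdef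
  set φ : μ → ℝ := dMinOp Λ Q Λ₁ Q₁ *ᵥ e with hφ
  set a : μ → ℝ := (Q₁ᵀ * effForm Λ Q - Λ₁ * minOp Λ Q) *ᵥ e with ha
  set b : μ → ℝ := Qᵀ *ᵥ (dEffForm Λ Q Λ₁ Q₁ *ᵥ e) with hb
  have h1 : φ ⬝ᵥ ((Λ - H) *ᵥ φ) ≤ C * (((Λ + m • 1) *ᵥ φ) ⬝ᵥ ((Λ + m • 1) *ᵥ φ)) :=
    sqConsistency_mass_of_propagatorDefect hH hH' hk hm hE φ
  have h2 := sq_add_mass_le Λ m φ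
  have hst : Λ *ᵥ φ = a + b := by
    rw [hφ, mulVec_mulVec, mul_dMinOp_eq Λ Λ₁ Q Q₁ hΛ, add_mulVec, ← mulVec_mulVec]
  have hpar : (a + b) ⬝ᵥ (a + b) ≤ 2 * (a ⬝ᵥ a) + 2 * (b ⬝ᵥ b) := by
    have h0 : 0 ≤ (a - b) ⬝ᵥ (a - b) := by
      simpa only [star_trivial, one_mulVec] using Matrix.PosSemidef.one.dotProduct_mulVec_nonneg (n := μ) (R := ℝ) (a - b)
    have hsym : b ⬝ᵥ a = a ⬝ᵥ b := dotProduct_comm b a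
    simp only [add_dotProduct, dotProduct_add, sub_dotProduct, dotProduct_sub, hsym] at h0 ⊢
    linarith
  rw [hst] at h2
  have h3 : ((Λ + m • 1) *ᵥ φ) ⬝ᵥ ((Λ + m • 1) *ᵥ φ) ≤ 4 * (a ⬝ᵥ a + b ⬝ᵥ b) + 2 * m ^ 2 * (φ ⬝ᵥ φ) := by linarith
  calc φ ⬝ᵥ ((Λ - H) *ᵥ φ) ≤ C * (((Λ + m • 1) *ᵥ φ) ⬝ᵥ ((Λ + m • 1) *ᵥ φ)) := h1
    _ ≤ C * (4 * (a ⬝ᵥ a + b ⬝ᵥ b) + 2 * m ^ 2 * (φ ⬝ᵥ φ)) := mul_le_mul_of_nonneg_left h3 hC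
    _ = 4 * C * (a ⬝ᵥ a + b ⬝ᵥ b) + 2 * C * m ^ 2 * (φ ⬝ᵥ φ) := by ring

end OneLevel

/-! ## §2 The tower END with a mass schedule -/

section Tower

variable {c : Type*} [Fintype c] [DecidableEq c]
variable {ι : ℕ → Type*} [∀ j, Fintype (ι j)] [∀ j, DecidableEq (ι j)]
variable {H : ∀ j, Matrix (ι j) (ι j) ℝ} {Qf : ∀ j, Matrix (ι j) (ι (j + 1)) ℝ} {Qc : ∀ j, Matrix c (ι j) ℝ}
variable {Λ₁ : ∀ j, Matrix (ι j) (ι j) ℝ} {Q₁ : ∀ j, Matrix c (ι j) ℝ} {m : ℕ → ℝ} {c₁ cF g V N μ' θ : ℝ}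

/-- **`jetRange_cons_rate_of_massSchedule` — THE DIRECT TOWER END WITH A PHYSICAL MASS** [our proof]: with `Λ_j := 𝒮(H (j+1), Qf j)`, `ℋ̃_{j,1} := dℋ(Λ_j,Qc_j;Λ₁ j,Q₁ j)`:
`H j ⪰ 0` ∀ j, nonsingular `kkt (H (j+1)) (Qf j)` and `kkt Λ_j (Qc j)`, a mass schedule `0 < m j`, `(m j)² ≤ μ′·θ^j`, the propagator row AT THAT ONE MASS
(E-ROW)_j `(H_j + m_j·1)⁻¹ − Qf_j(H_{j+1} + Qf_jᵀ(m_j·1)Qf_j)⁻¹Qf_jᵀ ≤ c₁·1` (`c₁ ≥ 0`), (SRC-f) `⟨f_{j,1}e,f_{j,1}e⟩ ≤ c_F θ^j⟨e,e⟩`, (AVG) `⟨(Qc j)ᵀw,(Qc j)ᵀw⟩ ≤ g θ^j⟨w,w⟩`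
(`g ≥ 0`), (VAL₁) `⟨𝒮₁e,𝒮₁e⟩ ≤ V⟨e,e⟩`, (LEGS) `⟨ℋ̃_{j,1}e,ℋ̃_{j,1}e⟩ ≤ N⟨e,e⟩`, `θ ≥ 0` ⟹ `⟨ℋ̃_{j,1}e,(Λ_j − H_j)ℋ̃_{j,1}e⟩ ≤ (4c₁(c_F + g·V) + 2c₁μ′N)·θ^j·⟨e,e⟩`
∀ j e.  (The schedule `m_j² ≤ μ′θ^j` is to be read against the normalisation of (LEGS) and the stiffness of `H_j` — gan24-idea-1 g53 W-1 (R-a): in units where `H_j` carries the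
stiffness `ξ_j = L^{(2−d)j}` and the minimiser legs are `l_j^d`-sized, the physical mass is `m_j = μ·ξ_j·η_j² = μη_j^d`; at `d = 2` this is `m_j = μη_j² = μL^{−2j}`, a FIXED mass
on the unit torus, and the schedule holds with `θ = L⁻⁴`.) -/
theorem jetRange_cons_rate_of_massSchedule (hH : ∀ j, (H j).PosSemidef) (hkf : ∀ j, IsUnit (kkt (H (j + 1)) (Qf j)).det)
    (hkΛ : ∀ j, IsUnit (kkt (effForm (H (j + 1)) (Qf j)) (Qc j)).det) (hc₁ : 0 ≤ c₁) (hg : 0 ≤ g) (hθ : 0 ≤ θ)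
    (hm : ∀ j, 0 < m j) (hmθ : ∀ j, m j ^ 2 ≤ μ' * θ ^ j)
    (hE : ∀ j (w : ι j → ℝ), w ⬝ᵥ (((H j + m j • (1 : Matrix (ι j) (ι j) ℝ))⁻¹ -
        blockProp (H (j + 1) + (Qf j)ᵀ * (m j • (1 : Matrix (ι j) (ι j) ℝ)) * Qf j) (Qf j)) *ᵥ w) ≤ c₁ * (w ⬝ᵥ w))
    (hF : ∀ j (e : c → ℝ),
      (((Q₁ j)ᵀ * effForm (effForm (H (j + 1)) (Qf j)) (Qc j) - Λ₁ j * minOp (effForm (H (j + 1)) (Qf j)) (Qc j)) *ᵥ e) ⬝ᵥ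
          (((Q₁ j)ᵀ * effForm (effForm (H (j + 1)) (Qf j)) (Qc j) - Λ₁ j * minOp (effForm (H (j + 1)) (Qf j)) (Qc j)) *ᵥ e) ≤ cF * θ ^ j * (e ⬝ᵥ e))
    (hQt : ∀ j (w : c → ℝ), ((Qc j)ᵀ *ᵥ w) ⬝ᵥ ((Qc j)ᵀ *ᵥ w) ≤ g * θ ^ j * (w ⬝ᵥ w))
    (hV : ∀ j (e : c → ℝ), (dEffForm (effForm (H (j + 1)) (Qf j)) (Qc j) (Λ₁ j) (Q₁ j) *ᵥ e) ⬝ᵥ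
      (dEffForm (effForm (H (j + 1)) (Qf j)) (Qc j) (Λ₁ j) (Q₁ j) *ᵥ e) ≤ V * (e ⬝ᵥ e))
    (hN : ∀ j (e : c → ℝ), (dMinOp (effForm (H (j + 1)) (Qf j)) (Qc j) (Λ₁ j) (Q₁ j) *ᵥ e) ⬝ᵥ
      (dMinOp (effForm (H (j + 1)) (Qf j)) (Qc j) (Λ₁ j) (Q₁ j) *ᵥ e) ≤ N * (e ⬝ᵥ e)) :
    ∀ j (e : c → ℝ), (dMinOp (effForm (H (j + 1)) (Qf j)) (Qc j) (Λ₁ j) (Q₁ j) *ᵥ e) ⬝ᵥ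
        ((effForm (H (j + 1)) (Qf j) - H j) *ᵥ (dMinOp (effForm (H (j + 1)) (Qf j)) (Qc j) (Λ₁ j) (Q₁ j) *ᵥ e)) ≤
      (4 * c₁ * (cF + g * V) + 2 * c₁ * μ' * N) * θ ^ j * (e ⬝ᵥ e) := fun j e => by
  have key := jet_constrained_energy_le_of_mass_defect (hH j) (hH (j + 1)) (hkf j) (hkΛ j) (hm j) hc₁ (hE j) (Λ₁ j) (Q₁ j) e
  have hθj : 0 ≤ θ ^ j := pow_nonneg hθ j
  have h2 := hQt j (dEffForm (effForm (H (j + 1)) (Qf j)) (Qc j) (Λ₁ j) (Q₁ j) *ᵥ e)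
  have h3 := hV j e
  have hb : ((Qc j)ᵀ *ᵥ (dEffForm (effForm (H (j + 1)) (Qf j)) (Qc j) (Λ₁ j) (Q₁ j) *ᵥ e)) ⬝ᵥ
      ((Qc j)ᵀ *ᵥ (dEffForm (effForm (H (j + 1)) (Qf j)) (Qc j) (Λ₁ j) (Q₁ j) *ᵥ e)) ≤ g * θ ^ j * (V * (e ⬝ᵥ e)) :=
    h2.trans (mul_le_mul_of_nonneg_left h3 (mul_nonneg hg hθj))
  have hee : 0 ≤ e ⬝ᵥ e := by
    simpa only [star_trivial, one_mulVec] using Matrix.PosSemidef.one.dotProduct_mulVec_nonneg (n := c) (R := ℝ) e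
  set φ : ι j → ℝ := dMinOp (effForm (H (j + 1)) (Qf j)) (Qc j) (Λ₁ j) (Q₁ j) *ᵥ e with hφ
  have hφφ : 0 ≤ φ ⬝ᵥ φ := by
    simpa only [star_trivial, one_mulVec] using Matrix.PosSemidef.one.dotProduct_mulVec_nonneg (n := ι j) (R := ℝ) φ
  have hmass : 2 * c₁ * m j ^ 2 * (φ ⬝ᵥ φ) ≤ 2 * c₁ * (μ' * θ ^ j) * (N * (e ⬝ᵥ e)) := by
    have hm2 : 0 ≤ m j ^ 2 := sq_nonneg _
    have h1 : m j ^ 2 * (φ ⬝ᵥ φ) ≤ μ' * θ ^ j * (φ ⬝ᵥ φ) := mul_le_mul_of_nonneg_right (hmθ j) hφφ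
    have h2 : μ' * θ ^ j * (φ ⬝ᵥ φ) ≤ μ' * θ ^ j * (N * (e ⬝ᵥ e)) := mul_le_mul_of_nonneg_left (hN j e) (hm2.trans (hmθ j))
    have h3 := mul_le_mul_of_nonneg_left (h1.trans h2) (by positivity : (0 : ℝ) ≤ 2 * c₁)
    linarith [h3]
  calc _ ≤ 4 * c₁ * (cF * θ ^ j * (e ⬝ᵥ e) + g * θ ^ j * (V * (e ⬝ᵥ e))) + 2 * c₁ * (μ' * θ ^ j) * (N * (e ⬝ᵥ e)) := by
        refine key.trans ?_
        have h4c : 0 ≤ 4 * c₁ := by positivity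
        nlinarith [mul_le_mul_of_nonneg_left (add_le_add (hF j e) hb) h4c, hmass]
    _ = (4 * c₁ * (cF + g * V) + 2 * c₁ * μ' * N) * θ ^ j * (e ⬝ᵥ e) := by ring

end Tower

/-! ## §3 Change of coarse frame: re-rooting the average ≡ conjugating the coarse form — (STAB) is a property of the PAIR (averaging, coarse form) -/

section Frame

variable {𝕜 : Type*} [Field 𝕜]
variable {ν μ : Type*} [Fintype ν] [Fintype μ] [DecidableEq ν] [DecidableEq μ]

/-- **`kktInv_frame` — CHANGE OF COARSE FRAME, all four blocks** [folklore; the `blocks_add_conj` pattern of an2's `CompositionSingular`]: for an invertible coarse frame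
change `A` (in the covariant toy: the diagonal unitary transporting each block's root to another root), `kkt H (A·Q)` is nonsingular iff `kkt H Q` is, and
`(kkt H (A·Q))⁻¹ = [[𝒢, ℋ·A⁻¹],[A⁻ᵀ·ℋᴸ, −A⁻ᵀ·𝒮·A⁻¹]]`: the fluctuation covariance is frame-blind, the minimiser and the effective form transform as a vector and a form. -/
theorem kktInv_frame (H : Matrix ν ν 𝕜) (Q : Matrix μ ν 𝕜) (A : Matrix μ μ 𝕜) (h : IsUnit (kkt H Q).det) (hA : IsUnit A.det) :
    (kkt H (A * Q))⁻¹ = fromBlocks (flucCov H Q) (minOp H Q * A⁻¹) ((A⁻¹)ᵀ * minOpL H Q) (-((A⁻¹)ᵀ * effForm H Q * A⁻¹)) := by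
  obtain ⟨h11, h12, h21, h22⟩ := kkt_mul_blocks H Q h
  have hAi : A * A⁻¹ = 1 := mul_nonsing_inv A hA
  have hAit : Aᵀ * (A⁻¹)ᵀ = 1 := by rw [← transpose_mul, nonsing_inv_mul A hA, transpose_one]
  apply inv_eq_right_inv
  rw [kkt_eq_fromBlocks, fromBlocks_multiply, transpose_mul]
  have e11 : H * flucCov H Q + Qᵀ * Aᵀ * ((A⁻¹)ᵀ * minOpL H Q) = 1 := by
    rw [Matrix.mul_assoc Qᵀ, ← Matrix.mul_assoc Aᵀ, hAit, Matrix.one_mul, h11]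
  have e12 : H * (minOp H Q * A⁻¹) + Qᵀ * Aᵀ * -((A⁻¹)ᵀ * effForm H Q * A⁻¹) = 0 := by
    rw [Matrix.mul_neg, Matrix.mul_assoc Qᵀ, Matrix.mul_assoc (A⁻¹)ᵀ, ← Matrix.mul_assoc Aᵀ, hAit, Matrix.one_mul, ← Matrix.mul_assoc H, h12,
      Matrix.mul_assoc Qᵀ, add_neg_eq_zero]
  have e21 : A * Q * flucCov H Q + (0 : Matrix μ μ 𝕜) * ((A⁻¹)ᵀ * minOpL H Q) = 0 := by
    rw [Matrix.zero_mul, add_zero, Matrix.mul_assoc, h21, Matrix.mul_zero]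
  have e22 : A * Q * (minOp H Q * A⁻¹) + (0 : Matrix μ μ 𝕜) * -((A⁻¹)ᵀ * effForm H Q * A⁻¹) = 1 := by
    rw [Matrix.zero_mul, add_zero, Matrix.mul_assoc, ← Matrix.mul_assoc Q, h22, Matrix.one_mul, hAi]
  rw [e11, e12, e21, e22, fromBlocks_one]

/-- **`effForm_frame`** [folklore]: `𝒮(H, A·Q) = A⁻ᵀ·𝒮(H, Q)·A⁻¹` for an invertible coarse frame change `A` (and `ℋ(H, A·Q) = ℋ(H,Q)·A⁻¹`, `𝒢` unchanged). -/
theorem effForm_frame (H : Matrix ν ν 𝕜) (Q : Matrix μ ν 𝕜) (A : Matrix μ μ 𝕜) (h : IsUnit (kkt H Q).det) (hA : IsUnit A.det) :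
    effForm H (A * Q) = (A⁻¹)ᵀ * effForm H Q * A⁻¹ ∧ minOp H (A * Q) = minOp H Q * A⁻¹ ∧ flucCov H (A * Q) = flucCov H Q := by
  have key := kktInv_frame H Q A h hA
  unfold effForm minOp flucCov at key ⊢
  rw [key, toBlocks_fromBlocks₂₂, toBlocks_fromBlocks₁₂, toBlocks_fromBlocks₁₁, neg_neg]
  exact ⟨rfl, rfl, rfl⟩

/-- **`effForm_frame_sub`** [folklore]: the one-step defect in the new frame is the CONGRUENT image of the defect against the CONJUGATED coarse form:
`𝒮(H′, A·q) − H = A⁻ᵀ·(𝒮(H′, q) − Aᵀ·H·A)·A⁻¹` — re-rooting the block average by `A` is the same as replacing the coarse form `H` by `AᵀHA`. -/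
theorem effForm_frame_sub (H' : Matrix ν ν 𝕜) (q : Matrix μ ν 𝕜) (A H : Matrix μ μ 𝕜) (h : IsUnit (kkt H' q).det) (hA : IsUnit A.det) :
    effForm H' (A * q) - H = (A⁻¹)ᵀ * (effForm H' q - Aᵀ * H * A) * A⁻¹ := by
  rw [(effForm_frame H' q A h hA).1, Matrix.mul_sub, Matrix.sub_mul]
  congr 1
  have hAi : A * A⁻¹ = 1 := mul_nonsing_inv A hA
  have hAit : (A⁻¹)ᵀ * Aᵀ = 1 := by rw [← transpose_mul, hAi, transpose_one]
  simp only [Matrix.mul_assoc]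
  rw [hAi, Matrix.mul_one, ← Matrix.mul_assoc, hAit, Matrix.one_mul]

end Frame

section FrameReal

variable {ν μ : Type*} [Fintype ν] [Fintype μ] [DecidableEq ν] [DecidableEq μ]

/-- **`stab_frame_iff` — (STAB) IS A PROPERTY OF THE PAIR (averaging, coarse form)** [folklore]: over `ℝ`, for an invertible coarse frame change `A`,
`𝒮(H′, A·q) − H ⪰ 0 ⟺ 𝒮(H′, q) − AᵀHA ⪰ 0` (congruence by `A⁻¹` ∕ `A`).  In the covariant toy of the records NOTE (kit j170995 ∕ j171386): re-rooting the taxi block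
average from the block centre to the block corner is, to first order, `q ↦ D·q` with `D` the diagonal transport root → root; (STAB) for the corner-rooted average against a
coarse form `H` is (STAB) for the centred average against `DᵀHD` — the STRAIGHT-PRODUCT coarse Laplacian conjugated by `D` differs from the centred one by an
`O(plaquette)` holonomy per link, which is what Bałaban's averaged coarse field `Ū` restores: the toy's «corner + straight FAILS, corner + `Ū` and centre + straight HOLD». -/
theorem stab_frame_iff (H' : Matrix ν ν ℝ) (q : Matrix μ ν ℝ) (A H : Matrix μ μ ℝ) (h : IsUnit (kkt H' q).det) (hA : IsUnit A.det) :
    (effForm H' (A * q) - H).PosSemidef ↔ (effForm H' q - Aᵀ * H * A).PosSemidef := by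
  rw [effForm_frame_sub H' q A H h hA]
  have hAu : IsUnit A := (Matrix.isUnit_iff_isUnit_det A).mpr hA
  have hAi : IsUnit A⁻¹ := Matrix.isUnit_nonsing_inv_iff.mpr hAu
  have key := (Matrix.IsUnit.posSemidef_star_left_conjugate_iff (x := effForm H' q - Aᵀ * H * A) hAi)
  -- `star (A⁻¹) = (A⁻¹)ᴴ = (A⁻¹)ᵀ` over `ℝ`
  rw [star_eq_conjTranspose, conjTranspose_eq_transpose_of_trivial] at key
  exact key

end FrameReal

end Summit.QuantumFields.BalabanUV.Beta.GAN24.DerivativeRateTransferPropagatorDefectEnd
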